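import Summits.ResolutionOfSingularities.ResolutionOfSingularities.Theorems.FrobeniusLadderFRationalResolutionTowerStep
import Summits.ResolutionOfSingularities.ResolutionOfSingularities.Theorems.FrobeniusLadderFRationalResolutionChartElimPow
import HarnessLib

/-!
# The `A_n` programme for rung 4′: the descent step `n + 2 ↦ n` and the resolution of all `Aₙ`

Support file for crux stmt-ResolutionOfSingularities-15317 (`FrobeniusLadder.FRationalResolution`),
line `Sketch`, continuation seat c3. With `P(n)` as in `…AnResolutionBase.lean` ("`Aₙ` receives a
proper morphism from a regular scheme which is an isomorphism over the complement `Uₙ` of the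
origin, with dense preimage of `Uₙ`"):

* `An_theta` — the test map `R_{n+2} → Rₙ[1/x̄ₙ]` feeding `stub_chart_elim_pow`;
* `An_xChart_package` — the `x`-chart of the blow-up of the origin of `A_{n+2}` IS `Aₙ`: an open
  immersion `Aₙ → Bl_0 A_{n+2}` onto `D₊(x̄t)` under which `D₊(ȳt)`, `D₊(z̄t)` pull back to
  `D(ȳₙ)`, `D(z̄ₙ)` and `D(x̄)` to `D(x̄ₙ)` (`stub_chart_elim_pow` + `xChart_openImmersion_of_range`);
* `An_offOrigin_resolution_step` — **`P(n) ⇒ P(n+2)`** (`towerStep` with the regular graph charts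
  `An_graphChart_isRegularRing` and the `x`-chart package);
* `An_offOrigin_resolution` — `P(n)` for all `n` (two-step induction from `P(0)`, `P(1)`);
* `hasResolution_An` — **every `Aₙ = Spec k[y,z,x]/(yz + x^(n+1))`, every field `k`, has a
  resolution of singularities**: rung 4′ verified on the whole `A_n` family by the genuine tower
  of `⌈n/2⌉` point blow-ups.

Elaboration note: the two declarations that juggle the two CONCRETE quotient rings `R_{n+2}`, `Rₙ`
at once carry `maxHeartbeats 400000`; every abstract step lives in `…TowerStep.lean`, the centre is
kept as an opaque family `v` (never `subst`ituted), and the ring `Rₙ[1/x̄ₙ]` is only ever addressed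
through ring homomorphisms (no `map_add` on algebra maps into it), which is what keeps instance
search and the kernel within budget.

All folklore (Kollár 2007 §2.2; Hartshorne II.7; Stacks 0804, 02OS); no published fact is used.
-/

-- single-problem summit: the doubled namespace component is forced
set_option linter.dupNamespace false

noncomputable section

namespace Summit.ResolutionOfSingularities.ResolutionOfSingularities.Theorems.FRationalResolution

open CategoryTheory AlgebraicGeometry TopologicalSpace MvPolynomial
open Literature.AlgebraicGeometry.Resolution

section AnStep

variable (k : Type) [Field k]

/-- The equation `gₙ = yz + x^(n+1)` of `Aₙ` in `k[y, z, x] = MvPolynomial (Fin 2 ⊕ Fin 1) k`. -/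
local notation3 "gA[" n "]" => (X (Sum.inl 0) * X (Sum.inl 1) + rename Sum.inr (X 0 ^ (n + 1)) :
  MvPolynomial (Fin 2 ⊕ Fin 1) k)

/-- The coordinate ring `Rₙ = k[y,z,x]/(gₙ)` of `Aₙ`. -/
local notation3 "RA[" n "]" => MvPolynomial (Fin 2 ⊕ Fin 1) k ⧸ Ideal.span {gA[n]}

/-- The class of a polynomial in `Rₙ`. -/
local notation3 "mkA[" n "]" => Ideal.Quotient.mk (Ideal.span {gA[n]})

/-- The complement `Uₙ = D(ȳ) ∪ D(z̄) ∪ D(x̄)` of the origin, an open of `Aₙ = Spec Rₙ`. -/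
local notation3 "UA[" n "]" => ((PrimeSpectrum.basicOpen (mkA[n] (X (Sum.inl 0))) ⊔
    PrimeSpectrum.basicOpen (mkA[n] (X (Sum.inl 1))) ⊔
    PrimeSpectrum.basicOpen (mkA[n] (X (Sum.inr 0)))) : (Spec (CommRingCat.of RA[n])).Opens)

/-- **The open `Uₙ ⊆ Aₙ` is a regular scheme** (its stalks are those of `Aₙ` off the origin,
`An_isRegularLocalRing_stalk_of_notMem`). [folklore] -/
theorem An_offOrigin_isRegular (n : ℕ) :
    Scheme.IsRegular ((UA[n] : (Spec (CommRingCat.of RA[n])).Opens) : Scheme.{0}) := by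
  refine isRegular_opens_of_stalk UA[n] fun p hp => An_isRegularLocalRing_stalk_of_notMem k n p ?_
  rcases hp with (h | h) | h
  · exact Or.inl h
  · exact Or.inr (Or.inl h)
  · exact Or.inr (Or.inr h)

/-- The test map `θ : R_{n+2} → Rₙ[1/x̄ₙ]`, `x ↦ x̄ₙ`, `y ↦ ȳₙ x̄ₙ`, `z ↦ z̄ₙ x̄ₙ` (well defined since
`(ȳₙ x̄ₙ)(z̄ₙ x̄ₙ) + x̄ₙ^(n+3) = x̄ₙ² (ȳₙ z̄ₙ + x̄ₙ^(n+1)) = 0`). Stated with the equation `g` of `Aₙ` as a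
VARIABLE (`hg : g = gₙ`), so that the algebra structures on `Rₙ[1/x̄ₙ]` are elaborated over an
opaque quotient (instantiate with `rfl`). [folklore] -/
theorem An_theta (n : ℕ) (g : MvPolynomial (Fin 2 ⊕ Fin 1) k) (hg : g = gA[n]) :
    ∃ θ : RA[n + 2] →ₐ[k]
        Localization.Away (Ideal.Quotient.mk (Ideal.span {g}) (X (Sum.inr 0))),
      θ (mkA[n + 2] (X (Sum.inr 0))) =
        algebraMap _ _ (Ideal.Quotient.mk (Ideal.span {g}) (X (Sum.inr 0))) ∧
      θ (mkA[n + 2] (X (Sum.inl 0))) = algebraMap _ _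
        (Ideal.Quotient.mk (Ideal.span {g}) (X (Sum.inl 0)) *
          Ideal.Quotient.mk (Ideal.span {g}) (X (Sum.inr 0))) ∧
      θ (mkA[n + 2] (X (Sum.inl 1))) = algebraMap _ _
        (Ideal.Quotient.mk (Ideal.span {g}) (X (Sum.inl 1)) *
          Ideal.Quotient.mk (Ideal.span {g}) (X (Sum.inr 0))) := by
  -- the relation `ā b̄ + c̄^(n+1) = 0` in `k[a,b,c]/(g)`
  have hr : (gA[n] : MvPolynomial (Fin 2 ⊕ Fin 1) k) =
      X (Sum.inl 0) * X (Sum.inl 1) + X (Sum.inr 0) ^ (n + 1) := by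
    simp only [map_pow, rename_X]
  have hrelg : Ideal.Quotient.mk (Ideal.span {g}) (X (Sum.inl 0)) *
      Ideal.Quotient.mk (Ideal.span {g}) (X (Sum.inl 1)) +
      Ideal.Quotient.mk (Ideal.span {g}) (X (Sum.inr 0)) ^ (n + 1) = 0 := by
    have h1 : Ideal.Quotient.mk (Ideal.span {g})
        (X (Sum.inl 0) * X (Sum.inl 1) + X (Sum.inr 0) ^ (n + 1)) = 0 := by
      rw [← hr, ← hg]
      exact Ideal.Quotient.eq_zero_iff_mem.mpr (Ideal.mem_span_singleton_self g)
    rwa [map_add, map_mul, map_pow] at h1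
  have hrelg' : Ideal.Quotient.mk (Ideal.span {g}) (X (Sum.inl 0)) *
      Ideal.Quotient.mk (Ideal.span {g}) (X (Sum.inr 0)) *
      (Ideal.Quotient.mk (Ideal.span {g}) (X (Sum.inl 1)) *
        Ideal.Quotient.mk (Ideal.span {g}) (X (Sum.inr 0))) +
      Ideal.Quotient.mk (Ideal.span {g}) (X (Sum.inr 0)) ^ (n + 2 + 1) = 0 := by
    linear_combination Ideal.Quotient.mk (Ideal.span {g}) (X (Sum.inr 0)) ^ 2 * hrelg
  -- the evaluation `θ₀ : k[y,z,x] → k[a,b,c]/(g) [1/c̄]`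
  let θ₀ : MvPolynomial (Fin 2 ⊕ Fin 1) k →ₐ[k]
      Localization.Away (Ideal.Quotient.mk (Ideal.span {g}) (X (Sum.inr 0))) :=
    aeval (Sum.elim
      ![algebraMap _ (Localization.Away (Ideal.Quotient.mk (Ideal.span {g}) (X (Sum.inr 0))))
          (Ideal.Quotient.mk (Ideal.span {g}) (X (Sum.inl 0)) *
            Ideal.Quotient.mk (Ideal.span {g}) (X (Sum.inr 0))),
        algebraMap _ (Localization.Away (Ideal.Quotient.mk (Ideal.span {g}) (X (Sum.inr 0))))
          (Ideal.Quotient.mk (Ideal.span {g}) (X (Sum.inl 1)) *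
            Ideal.Quotient.mk (Ideal.span {g}) (X (Sum.inr 0)))]
      ![algebraMap _ (Localization.Away (Ideal.Quotient.mk (Ideal.span {g}) (X (Sum.inr 0))))
          (Ideal.Quotient.mk (Ideal.span {g}) (X (Sum.inr 0)))])
  have hθ₀y : θ₀ (X (Sum.inl 0)) =
      algebraMap _ (Localization.Away (Ideal.Quotient.mk (Ideal.span {g}) (X (Sum.inr 0))))
        (Ideal.Quotient.mk (Ideal.span {g}) (X (Sum.inl 0)) *
          Ideal.Quotient.mk (Ideal.span {g}) (X (Sum.inr 0))) := by
    simp [θ₀]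
  have hθ₀z : θ₀ (X (Sum.inl 1)) =
      algebraMap _ (Localization.Away (Ideal.Quotient.mk (Ideal.span {g}) (X (Sum.inr 0))))
        (Ideal.Quotient.mk (Ideal.span {g}) (X (Sum.inl 1)) *
          Ideal.Quotient.mk (Ideal.span {g}) (X (Sum.inr 0))) := by
    simp [θ₀]
  have hθ₀x : θ₀ (X (Sum.inr 0)) =
      algebraMap _ (Localization.Away (Ideal.Quotient.mk (Ideal.span {g}) (X (Sum.inr 0))))
        (Ideal.Quotient.mk (Ideal.span {g}) (X (Sum.inr 0))) := by
    simp [θ₀]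
  have hr2 : (gA[n + 2] : MvPolynomial (Fin 2 ⊕ Fin 1) k) =
      X (Sum.inl 0) * X (Sum.inl 1) + X (Sum.inr 0) ^ (n + 2 + 1) := by
    simp only [map_pow, rename_X]
  have hθ₀g : θ₀ gA[n + 2] = 0 := by
    -- compute through the RING homomorphism `↑θ₀`: synthesising `Add` on the localisation of
    -- the quotient for the generic `map_add θ₀` exceeds the instance heartbeat budget
    have h := congrArg
      (algebraMap _ (Localization.Away (Ideal.Quotient.mk (Ideal.span {g}) (X (Sum.inr 0))))) hrelg'
    rw [RingHom.map_add, RingHom.map_mul, map_pow, RingHom.map_zero] at h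
    rw [hr2, ← AlgHom.coe_toRingHom, RingHom.map_add, RingHom.map_mul, map_pow,
      AlgHom.coe_toRingHom, hθ₀y, hθ₀z, hθ₀x]
    exact h
  have hker : ∀ s ∈ Ideal.span {gA[n + 2]}, θ₀ s = 0 := An_lift_aux k (n + 2) θ₀ hθ₀g
  let θ : RA[n + 2] →ₐ[k]
      Localization.Away (Ideal.Quotient.mk (Ideal.span {g}) (X (Sum.inr 0))) :=
    Ideal.Quotient.liftₐ (Ideal.span {gA[n + 2]}) θ₀ hker
  have hθmk : ∀ s, θ (mkA[n + 2] s) = θ₀ s := fun s =>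
    AlgHom.congr_fun (Ideal.Quotient.liftₐ_comp (Ideal.span {gA[n + 2]}) θ₀ hker) s
  exact ⟨θ, by rw [hθmk, hθ₀x], by rw [hθmk, hθ₀y], by rw [hθmk, hθ₀z]⟩

set_option maxHeartbeats 400000 in
/-- **The `x`-chart package of the blow-up of the origin of `A_{n+2}`.** With
`v = (ȳ, z̄, x̄) : Fin 3 → R_{n+2}` and `B = Bl_{(v)} A_{n+2}`: an open immersion `iV : Aₙ → B` with
range `D₊(x̄t)`, `iV⁻¹ D₊(ȳt) = D(ȳₙ)`, `iV⁻¹ D₊(z̄t) = D(z̄ₙ)` and `(iV ≫ π₀)⁻¹ D(x̄) = D(x̄ₙ)`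
(`An_theta` + `stub_chart_elim_pow` + `xChart_openImmersion_of_range`). Everything is phrased
through `v 0, v 1, v 2`, so that the only definitional unfoldings left to the kernel are
`![a, b, c] i = …`. [folklore; Kollár 2007 §2.2] -/
theorem An_xChart_package (n : ℕ) (v : Fin 3 → RA[n + 2])
    (hv : v = ![mkA[n + 2] (X (Sum.inl 0)), mkA[n + 2] (X (Sum.inl 1)), mkA[n + 2] (X (Sum.inr 0))]) :
    ∃ iV : Spec (CommRingCat.of RA[n]) ⟶ affineBlowup (Ideal.span (Set.range v)),
      IsOpenImmersion iV ∧
      (∀ p : affineBlowup (Ideal.span (Set.range v)), p ∈ Set.range iV ↔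
        p ∈ Proj.basicOpen (reesGrading (Ideal.span (Set.range v)))
          (reesT (v 2) (Ideal.mem_span_range_self (f := v) (x := 2)))) ∧
      iV ⁻¹ᵁ Proj.basicOpen (reesGrading (Ideal.span (Set.range v)))
          (reesT (v 0) (Ideal.mem_span_range_self (f := v) (x := 0))) =
        PrimeSpectrum.basicOpen (mkA[n] (X (Sum.inl 0))) ∧
      iV ⁻¹ᵁ Proj.basicOpen (reesGrading (Ideal.span (Set.range v)))
          (reesT (v 1) (Ideal.mem_span_range_self (f := v) (x := 1))) =
        PrimeSpectrum.basicOpen (mkA[n] (X (Sum.inl 1))) ∧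
      (iV ≫ affineBlowup.π (Ideal.span (Set.range v))) ⁻¹ᵁ
          (PrimeSpectrum.basicOpen (v 2) : (Spec (CommRingCat.of RA[n + 2])).Opens) =
        PrimeSpectrum.basicOpen (mkA[n] (X (Sum.inr 0))) := by
  -- everything through the opaque `v` (rewrite `hv` only inside the three small relations)
  have hrel : v 0 * v 1 + v 2 ^ (n + 1 + 2) = 0 := by
    rw [hv]; exact An_rel k (n + 2)
  have hgen : Algebra.adjoin k {v 2, v 0, v 1} = ⊤ := by
    rw [hv]; exact adjoin_mk_X_eq_top k gA[n + 2]
  obtain ⟨θ, hθx, hθy, hθz⟩ := An_theta k n gA[n] rfl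
  have hθx' : θ (v 2) = algebraMap _ _ (mkA[n] (X (Sum.inr 0))) := by rw [hv]; exact hθx
  have hθy' : θ (v 0) = algebraMap _ _ (mkA[n] (X (Sum.inl 0)) * mkA[n] (X (Sum.inr 0))) := by
    rw [hv]; exact hθy
  have hθz' : θ (v 1) = algebraMap _ _ (mkA[n] (X (Sum.inl 1)) * mkA[n] (X (Sum.inr 0))) := by
    rw [hv]; exact hθz
  obtain ⟨φ, hφinj, hφrange, hφc, hφa, hφb⟩ :=
    stub_chart_elim_pow k RA[n + 2] (n + 1) (v 2) (v 0) (v 1) hrel hgen θ hθx' hθy' hθz'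
  obtain ⟨iV, hiVoi, hrange, h₁, h₂, h₃⟩ := xChart_openImmersion_of_range RA[n + 2] (v 2) (v 0) (v 1)
    (Ideal.span (Set.range v)) (span_range_fin_three v) (Ideal.mem_span_range_self (x := 0))
    (Ideal.mem_span_range_self (x := 1)) (Ideal.mem_span_range_self (x := 2)) RA[n] φ hφinj
    hφrange _ _ _ hφc hφa hφb
  exact ⟨iV, hiVoi, fun p => by rw [hrange]; rfl, h₁, h₂, h₃⟩

set_option maxHeartbeats 400000 in
/-- **THE DESCENT STEP `P(n) ⇒ P(n+2)`** of the `A_n` programme. Blow up the origin of `A_{n+2}`: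
`π₀ : B = Bl_{(ȳ,z̄,x̄)} A_{n+2} → A_{n+2}` is proper, an isomorphism over `U_{n+2}` with dense
preimage of `D(ȳ)`; `B = D₊(ȳt) ∪ D₊(z̄t) ∪ D₊(x̄t)` with the first two charts regular (affine
planes, `An_graphChart_isRegularRing`) and the third equal to `Aₙ` (`An_xChart_package`, under which
`iV⁻¹ D₊(ȳt) = D(ȳₙ)`, `iV⁻¹ D₊(z̄t) = D(z̄ₙ)`, `(iV ≫ π₀)⁻¹ D(x̄) = D(x̄ₙ)`, so
`π₀⁻¹ U_{n+2} ⊆ D₊(ȳt) ∪ D₊(z̄t) ∪ iV(Uₙ)`); conclude with `towerStep`.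
[folklore; Kollár 2007 §2.2] -/
theorem An_offOrigin_resolution_step (n : ℕ)
    (ih : ∃ (Y : Scheme.{0}) (ρ : Y ⟶ Spec (CommRingCat.of RA[n])), IsProper ρ ∧
      Scheme.IsRegular Y ∧ IsIso (ρ ∣_ UA[n]) ∧ Dense ((ρ ⁻¹ᵁ UA[n] : Y.Opens) : Set Y)) :
    ∃ (X' : Scheme.{0}) (π : X' ⟶ Spec (CommRingCat.of RA[n + 2])), IsProper π ∧
      Scheme.IsRegular X' ∧ IsIso (π ∣_ UA[n + 2]) ∧
      Dense ((π ⁻¹ᵁ UA[n + 2] : X'.Opens) : Set X') := by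
  obtain ⟨Y, ρ, hρ, hYreg, hρiso, hρd⟩ := ih
  haveI := hρ
  -- the centre `I = (ȳ, z̄, x̄)` as the span of the family `v`
  obtain ⟨v, hv⟩ : ∃ v : Fin 3 → RA[n + 2],
      v = ![mkA[n + 2] (X (Sum.inl 0)), mkA[n + 2] (X (Sum.inl 1)), mkA[n + 2] (X (Sum.inr 0))] :=
    ⟨_, rfl⟩
  obtain ⟨hBy, hBz⟩ := An_graphChart_isRegularRing k (n + 2) (by omega)
  have hIv : Ideal.span (Set.range v) = Ideal.span {mkA[n + 2] (X (Sum.inr 0)),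
      mkA[n + 2] (X (Sum.inl 0)), mkA[n + 2] (X (Sum.inl 1))} := by
    rw [span_range_fin_three v, hv]
    rfl
  have hBy' : IsRegularRing (blowupAlgebra (Ideal.span (Set.range v)) (v 0)) := by
    rw [hIv, hv]; exact hBy
  have hBz' : IsRegularRing (blowupAlgebra (Ideal.span (Set.range v)) (v 1)) := by
    rw [hIv, hv]; exact hBz
  haveI := An_isDomain k (n + 2)
  have hy0 : v 0 ≠ 0 := fun h0 => by
    rw [hv] at h0
    exact X_inl_zero_notMem_span_suspensionPow k (n + 2) (Ideal.Quotient.eq_zero_iff_mem.mp h0)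
  haveI : IsNoetherianRing RA[n + 2] := inferInstance
  -- the `x`-chart `iV : Aₙ → B`
  obtain ⟨iV, hiVoi, hiVrange, hVy, hVz, hVπx⟩ := An_xChart_package k n v hv
  haveI := hiVoi
  -- `U_{n+2} = D(v 0) ∪ D(v 1) ∪ D(v 2)`
  have hU : (UA[n + 2] : (Spec (CommRingCat.of RA[n + 2])).Opens) =
      PrimeSpectrum.basicOpen (v 0) ⊔ PrimeSpectrum.basicOpen (v 1) ⊔
        PrimeSpectrum.basicOpen (v 2) := by
    rw [hv]; rfl
  rw [hU]
  refine towerStep (affineBlowup.π (Ideal.span (Set.range v))) _ ?_ (PrimeSpectrum.basicOpen (v 0))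
    (fun p hp => Or.inl (Or.inl hp))
    (affineBlowup.dense_preimage_basicOpen (I := Ideal.span (Set.range v)) (v 0)
      (Ideal.mem_span_range_self (x := 0)) hy0)
    _ _ (fun p hp => affineBlowup_chart_regular_piece _ (v 0) _ hBy' p hp)
    (fun p hp => affineBlowup_chart_regular_piece _ (v 1) _ hBz' p hp)
    iV UA[n] (An_offOrigin_isRegular k n)
    (by rw [hVy]; intro q hq; exact Or.inl (Or.inl hq))
    (by rw [hVz]; intro q hq; exact Or.inl (Or.inr hq))
    (fun p => ?_) ?_ ρ hYreg hρiso hρd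
  · -- `π₀` is an isomorphism over the complement of the centre
    exact isIso_morphismRestrict_sup _ (isIso_morphismRestrict_sup _
      (affineBlowup.isIso_morphismRestrict (I := Ideal.span (Set.range v)) _
        (Ideal.mem_span_range_self (x := 0)))
      (affineBlowup.isIso_morphismRestrict (I := Ideal.span (Set.range v)) _
        (Ideal.mem_span_range_self (x := 1))))
      (affineBlowup.isIso_morphismRestrict (I := Ideal.span (Set.range v)) _
        (Ideal.mem_span_range_self (x := 2)))
  · exact tower_cover v iV hiVrange p
  · exact tower_hle v iV UA[n] hiVrange (by rw [hVπx]; intro q hq; exact Or.inr hq)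

/-- **`P(n)` for every `n`**: two-step induction from `P(0)` (`A₀` regular) and `P(1)` (the quadric
cone) along the descent step. [folklore] -/
theorem An_offOrigin_resolution (n : ℕ) :
    ∃ (X' : Scheme.{0}) (π : X' ⟶ Spec (CommRingCat.of RA[n])), IsProper π ∧
      Scheme.IsRegular X' ∧ IsIso (π ∣_ UA[n]) ∧ Dense ((π ⁻¹ᵁ UA[n] : X'.Opens) : Set X') := by
  induction n using Nat.twoStepInduction with
  | zero => exact An_offOrigin_resolution_zero k
  | one => exact An_offOrigin_resolution_one k
  | more n ih _ => exact An_offOrigin_resolution_step k n ih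

end AnStep

/-- **RUNG 4′ ON THE WHOLE `A_n` FAMILY.** For every field `k` (every characteristic) and every
`n`, the surface `Aₙ = Spec k[y,z,x]/(yz + x^(n+1))` — a member of the residual class of the crux
by the c2 calibration, singular for `n ≥ 1` — HAS A RESOLUTION OF SINGULARITIES, obtained by the
genuine tower of `⌈n/2⌉` point blow-ups. [folklore; Kollár 2007 §2.2] -/
theorem hasResolution_An (k : Type) [Field k] (n : ℕ) :
    Scheme.HasResolution (Spec (CommRingCat.of (MvPolynomial (Fin 2 ⊕ Fin 1) k ⧸ Ideal.span
      {(MvPolynomial.X (Sum.inl 0) * MvPolynomial.X (Sum.inl 1) +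
        MvPolynomial.rename Sum.inr (MvPolynomial.X 0 ^ (n + 1)) : MvPolynomial (Fin 2 ⊕ Fin 1) k)}))) :=
  An_hasResolution_of_offOrigin_resolution k n (An_offOrigin_resolution k n)


end Summit.ResolutionOfSingularities.ResolutionOfSingularities.Theorems.FRationalResolution

end

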